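import Summits.ResolutionOfSingularities.ResolutionOfSingularities.Theorems.EquisingularLiftEquisingularLiftNatInCarrierStepFlatRing
import Summits.ResolutionOfSingularities.ResolutionOfSingularities.Theorems.EquisingularLiftEquisingularLiftNatCarrierStrictTransformStalks
import Summits.ResolutionOfSingularities.ResolutionOfSingularities.Theorems.EquisingularLiftEquisingularLiftNatSectionStep
import Summits.ResolutionOfSingularities.ResolutionOfSingularities.Theorems.EquisingularLiftEquisingularLiftNatRegularOfFlatModel
import Literature.AlgebraicGeometry.Resolution.MonomialMarkedIdealsBlowup
import Literature.AlgebraicGeometry.Resolution.BlowupsFlatBaseChange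
import HarnessLib

/-!
# [OURS · L1 W4.5(b) · EL♮(3)] T-STFLAT (K7b of the HSUB′(ReachTC⁺)₃ brick table): after an in-carrier SECTION step the new centre
# candidate `St_τ(𝓢) ⊔ St_τ(K)` is FLAT over `Spec O` (crux `EquisingularLiftNatThree` stmt-ResolutionOfSingularities-20148, parent
# `EquisingularLiftNat` stmt-20038; rung v7 (TC⁺), registered stub `stub_elnat_tcPlusPointResolution`; driver `hsub_reachTCPlus_of_invariant`
# p526242 of res-L1-w45b-stub-1, bricks `inv_step_regular` / `inv_step_singular`, invariant clause (ii) `Flat ((𝓢 ⊔ K).subschemeι ≫ σ ≫ q)`)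

NOT a statement of any manuscript. Helper file of the chain res-L1-w45b (cell `res-hironaka`, LADDER-RESOLUTION rung L, slot W4.5(b));
OURS; AI-written, weaker than expert review; `--supports stmt-ResolutionOfSingularities-20148 --as helper` by res-L1-w45b-stub-2 (object
K7b = T-STFLAT, res-L1-w45b-stub-1's BRICK DEAL 2026-08-27T11:31:42Z; exact signature PATH-ANNOUNCED 11:52:36Z). No `sorry`; standard axioms.

SETTING. `O` a DVR (uniformizer `ϖ`), `r : X → Spec O` separated with a section `s`, `p = s(s₀)`; `τ : X′ → X` the blow-up of `ker s`;
`(𝓢, K)` the in-carrier pair of the invariant (`𝓢` the regular carrier, `K` the cone hypersurface) with `V(𝓢 ⊔ K) → Spec O` flat; at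
`A = 𝒪_{X,p}` the CARRIER CONE PACK of res-L1-w45b-stub-1's …NatCarrierStrictTransformStalks (p522194): `(ker s)_p = (c)`, `c : Fin (n+1) → A`,
`𝓢_p = (c₀)`, `K_p = (Φ(c′))` for a tail form `Φ` of degree `m` with `Φ mod 𝔪 ≠ 0`, together with `(c) + (ϖ_A) = 𝔪_A` and `dim A = n + 2`
(res-L1-w45b-stub-2 T-DIM p513633) — from which the companion ring file derives quasi-regularity, the domain conditions and «no vertical
component» (so they are NOT binders here).

* `mem_stalkIdeal_carrierStrictTransform_of_varpi_mul_mem` — at a point `x′` of the centre over `p`: `τ^♯(ϖ_A)·a ∈ (St 𝓢 ⊔ St K)_{x′} ⇒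
  a ∈ (St 𝓢 ⊔ St K)_{x′}` (stalks = `(χ e₀) + (χ Φ(e′))` by p522194; ring core `mem_carrierSup_of_uniformizer_mul_mem` of the companion file);
* `mem_stalkIdeal_carrierStrictTransform_of_mul_mem_of_not_mem_support` — at a point `x′` NOT over `supp (ker s)` the blow-up is a local
  isomorphism (`IsBlowup.isIso_compl`, `isIso_stalkMap_of_isIso_morphismRestrict`) and `St = total transform`
  (`stalkIdeal_strictTransformIdeal_of_not_mem_support`), so nonzerodivisors modulo `(𝓢 ⊔ K)_{τ x′}` transport;
* `mem_stalkIdeal_of_varpi_mul_mem_of_flat` — downstairs, `Flat (V(C) → Spec O)` makes the germ of `ϖ` a nonzerodivisor modulo `C_y`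
  (`mem_nonZeroDivisors_Γgerm_appTop_of_flat`, …NatRegularOfFlatModel);
* **`flat_carrierStrictTransform_subschemeι_comp`** — K7b: `Flat ((St_τ 𝓢 ⊔ St_τ K).subschemeι ≫ τ ≫ r)`. Assembly = res-type-100's F3a
  `flat_carrierDelta_subschemeι_comp` (p512232): flatness is affine-local on the centre, over the principal ring `Γ(Spec O) ≅ O` flat =
  torsion-free, and `ϖ` is a nonzerodivisor on sections because it is one on every stalk (unit over the generic point; the two lemmas above
  over the closed point; `support_ker_inter_preimage_closedPoint_of_section` decides «over `p`» vs «off the section»);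
  `…_comp_stage` — the same in the stage spelling of `TCPlus.Member` (ii) (base `σ ≫ q`, conclusion for `(τ ≫ σ) ≫ q`).

References: R. Hartshorne, *Algebraic Geometry* (1977), III Prop. 9.7 [cite: Hartshorne1977]; H. Matsumura, *Commutative Ring Theory* (1986),
Thm. 7.7, Thm. 14.2; U. Görtz, T. Wedhorn, *Algebraic Geometry I* (2020), Prop. 13.91 (3). Tree inputs: p522194, p512232, p527131/…NatRegularOfFlatModel,
…NatSectionStep, Literature MonomialMarkedIdealsBlowup / BlowupsFlatBaseChange / AlterationsSectionDivisor.
-/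

set_option linter.dupNamespace false -- mandated namespace `Summit.<Summit>.<Problem>` of this single-conjunct summit
set_option linter.overlappingInstances false -- signatures carry `[IsDomain O] [IsDiscreteValuationRing O]`

noncomputable section

namespace Summit.ResolutionOfSingularities.ResolutionOfSingularities.Cruxes.EquisingularLiftNat.Sections

open IsLocalRing Literature.AlgebraicGeometry.Resolution

/-! ## Stalk level: `ϖ` is a nonzerodivisor modulo `St(𝓢) ⊔ St(K)` at the points over the special point of the section -/

section Stalk

open CategoryTheory AlgebraicGeometry TopologicalSpace
open Summit.ResolutionOfSingularities.ResolutionOfSingularities.Cruxes.EquisingularLift.StrataSplit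

variable {X X' : Scheme.{0}} {τ : X' ⟶ X} {J : X.IdealSheafData}

set_option maxHeartbeats 800000 in -- chart algebra `blowupAlgebra` = subalgebra of a localisation: slow unification (cf. p522194)
/-- **`ϖ` is a nonzerodivisor on `𝒪_{X',x'}/(St 𝓢 ⊔ St K)_{x'}` at a point `x'` over the special point `p` of the section.**
Blow-up `τ` of `X` along `J`, `x' ∈ supp (St 𝓢 ⊔ St K)` with `τ x' = p ∈ supp J`; at `A = 𝒪_{X,p}`: `J_p = (c)` for
`c : Fin (n+1) → A`, `𝓢_p = (c₀)`, `K_p = (Φ(c′))` for a tail form `Φ` of degree `m` with `Φ mod 𝔪 ≠ 0`, and `(c) + (ϖ_A) = 𝔪_A`,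
`dim A = n + 2` for the germ `ϖ_A` of a global section `v` (in use `v = r^*ϖ`). Then `τ^♯(ϖ_A)·a ∈ (St 𝓢 ⊔ St K)_{x'} ⇒
a ∈ (St 𝓢 ⊔ St K)_{x'}`. (Variable point `p` with `τ x' = p`, as in res-type-100's F3a, so that data at a named point apply without
transport.) [cite: Hartshorne1977, III Prop. 9.7 p. 257] -/
theorem mem_stalkIdeal_carrierStrictTransform_of_varpi_mul_mem [IsLocallyNoetherian X] [IsLocallyNoetherian X']
    (hτ : IsBlowup τ J) (𝓢 K : X.IdealSheafData) (x' : X') (p : X) (hp : τ x' = p) (hpJ : p ∈ (J.support : Set X))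
    {n : ℕ} (c : Fin (n + 1) → X.presheaf.stalk p) (hcJ : Ideal.span (Set.range c) = stalkIdeal J p)
    (h𝓢 : stalkIdeal 𝓢 p = Ideal.span {c 0}) {m : ℕ} (Φ : MvPolynomial (Fin n) (X.presheaf.stalk p))
    (hΦd : Φ.IsHomogeneous m) (hK : stalkIdeal K p = Ideal.span {MvPolynomial.eval (fun l => c l.succ) Φ}) (v : Γ(X, ⊤))
    (h𝔪 : Ideal.span (Set.range c) ⊔ Ideal.span {(X.presheaf.Γgerm p).hom v} = IsLocalRing.maximalIdeal (X.presheaf.stalk p))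
    (hdim : ringKrullDim (X.presheaf.stalk p) = (n + 2 : ℕ))
    (hΦ𝔪 : MvPolynomial.map (IsLocalRing.residue (X.presheaf.stalk p)) Φ ≠ 0)
    (hx' : x' ∈ ((strictTransformIdeal τ J 𝓢 ⊔ strictTransformIdeal τ J K).support : Set X'))
    (a : X'.presheaf.stalk x')
    (ha : (τ.stalkMap x').hom ((X.presheaf.Γgerm (τ x')).hom v) * a ∈
      stalkIdeal (strictTransformIdeal τ J 𝓢 ⊔ strictTransformIdeal τ J K) x') :
    a ∈ stalkIdeal (strictTransformIdeal τ J 𝓢 ⊔ strictTransformIdeal τ J K) x' := by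
  subst hp
  obtain ⟨ϖR, hϖR⟩ : ∃ ϖR : X.presheaf.stalk (τ x'), (X.presheaf.Γgerm (τ x')).hom v = ϖR := ⟨_, rfl⟩
  rw [hϖR] at h𝔪 ha
  -- the regular system of parameters `(ϖ_A, c)`: the side conditions of the stalk theorem and of the ring core
  haveI : IsDomain (X.presheaf.stalk (τ x') ⧸ Ideal.span (Set.range c)) :=
    isDomain_quotient_of_sup_span_singleton_eq c ϖR h𝔪 hdim
  haveI := isDomain_quotQuot_of_sup_span_singleton_eq c ϖR h𝔪 hdim
  have hc : IsQuasiRegular c := (isRsopPart_of_sup_span_singleton_eq c ϖR h𝔪 hdim).isQuasiRegular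
  have hcb := isQuasiRegular_tail_of_sup_span_singleton_eq c ϖR h𝔪 hdim
  obtain ⟨hϖc, -, hcl⟩ := notMem_of_sup_span_singleton_eq c ϖR h𝔪 hdim
  have hϖ0 := mk_uniformizer_mem_nonZeroDivisors_of_sup_span_singleton_eq c ϖR h𝔪 hdim
  have hΦϖ := eval_tail_notMem_of_sup_span_singleton_eq c ϖR h𝔪 hdim hΦd hΦ𝔪
  have hI𝔪 : Ideal.span (Set.range c) ≤ IsLocalRing.maximalIdeal (X.presheaf.stalk (τ x')) := h𝔪 ▸ le_sup_left
  have hΦ : MvPolynomial.map (Ideal.Quotient.mk (Ideal.span (Set.range c))) Φ ≠ 0 :=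
    map_mk_ne_zero_of_map_residue_ne_zero hI𝔪 hΦ𝔪
  -- `x' ∈ supp St(𝓢)`
  have hx'S : x' ∈ (strictTransformIdeal τ J 𝓢).support := by
    have h := hx'
    rw [Scheme.IdealSheafData.support_sup] at h
    exact h.1
  obtain ⟨j', 𝔔, χ, e, hχ, he, -, -, hSt𝓢, hStK, -, -⟩ :=
    exists_stalk_carrierStrictTransform hτ 𝓢 K x' hpJ c hcJ hc hcb h𝓢 Φ hΦd hΦ hK hx'S
  letI := χ.toAlgebra
  haveI : IsLocalization.AtPrime (X'.presheaf.stalk x') 𝔔.asIdeal := isLocalization_stalk_of_ringEquiv 𝔔 x' χ e he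
  -- `(St 𝓢 ⊔ St K)_{x'} = ((e₀) + (Φ(e′))) · 𝒪_{X',x'}` and `τ^♯ ϖ_A = χ (ϖ_A/1)`
  have hCmap : stalkIdeal (strictTransformIdeal τ J 𝓢 ⊔ strictTransformIdeal τ J K) x' =
      (Ideal.span {blowupAlgebra.frac c j'.succ 0} ⊔
        Ideal.span {MvPolynomial.aeval (fun l => blowupAlgebra.frac c j'.succ l.succ) Φ}).map
        (algebraMap (blowupAlgebra (Ideal.span (Set.range c)) (c j'.succ)) (X'.presheaf.stalk x')) := by
    rw [stalkIdeal_sup, hSt𝓢, hStK, Ideal.map_sup, Ideal.map_span, Ideal.map_span, Set.image_singleton, Set.image_singleton]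
    rfl
  have hϖ : (τ.stalkMap x').hom ϖR =
      algebraMap (blowupAlgebra (Ideal.span (Set.range c)) (c j'.succ)) (X'.presheaf.stalk x')
        (algebraMap _ (blowupAlgebra (Ideal.span (Set.range c)) (c j'.succ)) ϖR) := (hχ ϖR).symm
  rw [hCmap] at ha ⊢
  rw [hϖ] at ha
  exact mem_map_of_mul_mem_localization 𝔔.asIdeal.primeCompl (X'.presheaf.stalk x')
    (fun y hy => mem_carrierSup_of_uniformizer_mul_mem c j' ϖR hc hcb hϖ0 hϖc (hcl j'.succ (Fin.succ_ne_zero _)) hΦd hΦϖ y hy)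
    a ha

/-- **Off the centre: `ϖ` is a nonzerodivisor modulo `St(𝓢) ⊔ St(K)` wherever it is one modulo `𝓢 ⊔ K` downstairs.** At a
point `x'` with `τ x' ∉ supp J` the blow-up is a local isomorphism and both strict transforms are total transforms; so if
`w·b ∈ (𝓢 ⊔ K)_{τ x'} ⇒ b ∈ (𝓢 ⊔ K)_{τ x'}` for an element `w ∈ 𝒪_{X,τ x'}`, then `τ^♯(w)·a ∈ (St 𝓢 ⊔ St K)_{x'} ⇒
a ∈ (St 𝓢 ⊔ St K)_{x'}`. [cite: GortzWedhorn2020, Prop. 13.91 (3)] -/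
theorem mem_stalkIdeal_carrierStrictTransform_of_mul_mem_of_not_mem_support [IsLocallyNoetherian X']
    (hτ : IsBlowup τ J) (𝓢 K : X.IdealSheafData) (x' : X') (hx' : τ x' ∉ (J.support : Set X))
    (w : X.presheaf.stalk (τ x'))
    (hw : ∀ b : X.presheaf.stalk (τ x'), w * b ∈ stalkIdeal (𝓢 ⊔ K) (τ x') → b ∈ stalkIdeal (𝓢 ⊔ K) (τ x'))
    (a : X'.presheaf.stalk x')
    (ha : (τ.stalkMap x').hom w * a ∈ stalkIdeal (strictTransformIdeal τ J 𝓢 ⊔ strictTransformIdeal τ J K) x') :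
    a ∈ stalkIdeal (strictTransformIdeal τ J 𝓢 ⊔ strictTransformIdeal τ J K) x' := by
  have hSt : stalkIdeal (strictTransformIdeal τ J 𝓢 ⊔ strictTransformIdeal τ J K) x' =
      (stalkIdeal (𝓢 ⊔ K) (τ x')).map (τ.stalkMap x').hom := by
    rw [stalkIdeal_sup, stalkIdeal_strictTransformIdeal_of_not_mem_support J 𝓢 hx',
      stalkIdeal_strictTransformIdeal_of_not_mem_support J K hx', stalkIdeal_sup, Ideal.map_sup]
  -- `τ^♯` is an isomorphism at `x'`
  haveI : IsIso (τ ∣_ ⟨(J.support : Set X)ᶜ, J.support.isClosed.isOpen_compl⟩) := hτ.isIso_compl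
  haveI : IsIso (τ.stalkMap x') :=
    isIso_stalkMap_of_isIso_morphismRestrict τ ⟨(J.support : Set X)ᶜ, J.support.isClosed.isOpen_compl⟩ x' hx'
  have hbij := ConcreteCategory.bijective_of_isIso (τ.stalkMap x')
  rw [hSt] at ha ⊢
  obtain ⟨b, rfl⟩ := hbij.2 a
  rw [← map_mul] at ha
  obtain ⟨b', hb', hbb'⟩ := (Ideal.mem_map_iff_of_surjective _ hbij.2).mp ha
  have heq : b' = w * b := hbij.1 hbb'
  rw [heq] at hb'
  exact Ideal.mem_map_of_mem _ (hw b hb')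

/-- **Downstairs: flatness of `V(𝓢 ⊔ K) → Spec O` makes `ϖ` a nonzerodivisor modulo `(𝓢 ⊔ K)_y` at every point `y` of its
support.** (`𝒪_{V(C),z} ≅ 𝒪_{X,y}/C_y`; along a flat morphism to `Spec` of a domain the germ of `ϖ ≠ 0` is a nonzerodivisor,
…NatRegularOfFlatModel `mem_nonZeroDivisors_Γgerm_appTop_of_flat`.) [cite: Matsumura1987, Thm. 7.7 and §7] -/
theorem mem_stalkIdeal_of_varpi_mul_mem_of_flat {O : Type} [CommRing O] [IsDomain O] (r : X ⟶ Spec (.of O))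
    (C : X.IdealSheafData) [Flat (C.subschemeι ≫ r)] (y : X) (hy : y ∈ (C.support : Set X)) {ϖ : O} (hϖ : ϖ ≠ 0)
    (b : X.presheaf.stalk y)
    (hb : (X.presheaf.Γgerm y).hom (r.appTop.hom ((Scheme.ΓSpecIso (.of O)).inv.hom ϖ)) * b ∈ stalkIdeal C y) :
    b ∈ stalkIdeal C y := by
  rw [← Scheme.IdealSheafData.range_subschemeι] at hy
  obtain ⟨z, rfl⟩ := hy
  have hker : RingHom.ker (C.subschemeι.stalkMap z).hom = stalkIdeal C (C.subschemeι z) := by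
    rw [← stalkIdeal_ker_eq_ker_stalkMap, Scheme.IdealSheafData.ker_subschemeι]
  have hnzd := mem_nonZeroDivisors_Γgerm_appTop_of_flat (C.subschemeι ≫ r) z hϖ
  rw [Scheme.Hom.comp_appTop, CommRingCat.hom_comp, RingHom.comp_apply, ← stalkMap_Γgerm_apply'] at hnzd
  rw [← hker, RingHom.mem_ker] at hb ⊢
  rw [map_mul] at hb
  exact (mul_left_mem_nonZeroDivisors_eq_zero_iff hnzd).mp hb

end Stalk

/-! ## K7b: the in-carrier centre after a section step is flat over `Spec O` -/

section Flat

open CategoryTheory AlgebraicGeometry TopologicalSpace Opposite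
open Summit.ResolutionOfSingularities.ResolutionOfSingularities.Cruxes.EquisingularLift.StrataSplit

/-- **K7b = T-STFLAT: after an in-carrier SECTION step the new centre candidate `St_τ(𝓢) ⊔ St_τ(K)` is FLAT over `Spec O`.**
`O` a DVR with uniformizer `ϖ`; `r : X → Spec O` separated with a section `s`; `τ : X′ → X` the blow-up of `ker s` (`X`, `X′`
locally Noetherian); `(𝓢, K)` the in-carrier pair with `V(𝓢 ⊔ K) → Spec O` flat (the OLD clause (ii)); at `A = 𝒪_{X, s(s₀)}` the
carrier cone pack `(ker s)_p = (c)`, `𝓢_p = (c₀)`, `K_p = (Φ(c′))` (`Φ` a tail form of degree `m`, `Φ mod 𝔪 ≠ 0`) and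
`(c) + (ϖ_A) = 𝔪_A`, `dim A = n + 2` (T-DIM). Then `V(St_τ 𝓢 ⊔ St_τ K) → X′ → X → Spec O` is flat: torsion-free = flat over the
principal ring `Γ(Spec O) ≅ O`, and `ϖ` is a nonzerodivisor on every stalk of the centre — a unit over the generic point; over
the special point of the section by `mem_stalkIdeal_carrierStrictTransform_of_varpi_mul_mem` (carrier chart + T-M1-FLAT); at the
other special points the blow-up is a local isomorphism and the OLD flatness transports. Proof skeleton = res-type-100's F3a
`flat_carrierDelta_subschemeι_comp` (p512232). [cite: Hartshorne1977, III Prop. 9.7 p. 257] [OURS · L1 W4.5b] K7b of res-L1-w45b-stub-1's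
HSUB′(ReachTC⁺)₃ brick table toward `stub_elnat_tcPlusPointResolution`; NOT a statement of the manuscript. -/
theorem flat_carrierStrictTransform_subschemeι_comp (O : Type) [CommRing O] [IsDomain O] [IsDiscreteValuationRing O]
    {X X' : Scheme.{0}} (r : X ⟶ Spec (.of O)) [IsSeparated r]
    (s : Spec (.of O) ⟶ X) (hs : s ≫ r = 𝟙 _) (τ : X' ⟶ X) (hτ : IsBlowup τ s.ker)
    [IsLocallyNoetherian X] [IsLocallyNoetherian X']
    (𝓢 K : X.IdealSheafData) (hflat : Flat ((𝓢 ⊔ K).subschemeι ≫ r))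
    {n : ℕ} (c : Fin (n + 1) → X.presheaf.stalk (s (IsLocalRing.closedPoint O)))
    (hcJ : Ideal.span (Set.range c) = stalkIdeal s.ker (s (IsLocalRing.closedPoint O)))
    (h𝓢 : stalkIdeal 𝓢 (s (IsLocalRing.closedPoint O)) = Ideal.span {c 0})
    {m : ℕ} (Φ : MvPolynomial (Fin n) (X.presheaf.stalk (s (IsLocalRing.closedPoint O)))) (hΦd : Φ.IsHomogeneous m)
    (hK : stalkIdeal K (s (IsLocalRing.closedPoint O)) = Ideal.span {MvPolynomial.eval (fun l => c l.succ) Φ})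
    (ϖ : O) (hϖ : Irreducible ϖ)
    (h𝔪 : Ideal.span (Set.range c) ⊔ Ideal.span {(X.presheaf.Γgerm (s (IsLocalRing.closedPoint O))).hom
        (r.appTop.hom ((Scheme.ΓSpecIso (.of O)).inv.hom ϖ))} =
      IsLocalRing.maximalIdeal (X.presheaf.stalk (s (IsLocalRing.closedPoint O))))
    (hdim : ringKrullDim (X.presheaf.stalk (s (IsLocalRing.closedPoint O))) = (n + 2 : ℕ))
    (hΦ𝔪 : MvPolynomial.map (IsLocalRing.residue (X.presheaf.stalk (s (IsLocalRing.closedPoint O)))) Φ ≠ 0) :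
    Flat ((strictTransformIdeal τ s.ker 𝓢 ⊔ strictTransformIdeal τ s.ker K).subschemeι ≫ τ ≫ r) := by
  haveI := hflat
  -- adapted from `flat_carrierDelta_subschemeι_comp` (…NatCarrierDeltaFlat, res-type-100)
  set C' := strictTransformIdeal τ s.ker 𝓢 ⊔ strictTransformIdeal τ s.ker K with hC'
  apply HasRingHomProperty.of_iSup_eq_top (P := @Flat) (fun V : C'.subscheme.affineOpens => V) (iSup_affineOpens_eq_top _)
  intro V
  letI := ((C'.subschemeι ≫ τ ≫ r).appLE ⊤ (V : C'.subscheme.Opens) le_top).hom.toAlgebra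
  change Module.Flat Γ(Spec (.of O), ⊤) Γ(C'.subscheme, V)
  -- `Γ(Spec O, ⊤) ≅ O` is a principal ideal domain
  let eR : O ≃+* Γ(Spec (.of O), ⊤) := (Scheme.ΓSpecIso (.of O)).symm.commRingCatIsoToRingEquiv
  haveI : IsDomain Γ(Spec (.of O), ⊤) := MulEquiv.isDomain O eR.symm.toMulEquiv
  haveI : IsPrincipalIdealRing Γ(Spec (.of O), ⊤) := IsPrincipalIdealRing.of_surjective eR.toRingHom eR.surjective
  rw [Module.Flat.flat_iff_torsion_eq_bot_of_isBezout, ← Submodule.isTorsionFree_iff_torsion_eq_bot]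
  refine ⟨fun ρ hρ => ?_⟩
  rw [isSMulRegular_iff_right_eq_zero_of_smul]
  intro μ hμ
  rw [Algebra.smul_def] at hμ
  change ((C'.subschemeι ≫ τ ≫ r).appLE ⊤ _ le_top).hom ρ * μ = 0 at hμ
  -- `ρ = u ϖⁿ`
  have hρ0 : eR.symm ρ ≠ 0 := fun h => hρ.ne_zero (by simpa using congrArg eR h)
  obtain ⟨N, u, hu⟩ := IsDiscreteValuationRing.eq_unit_mul_pow_irreducible hρ0 hϖ
  have hρeq : ρ = eR (u : O) * eR ϖ ^ N := by
    rw [← map_pow, ← map_mul, ← hu, RingEquiv.apply_symm_apply]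
  have heR : ∀ a : O, eR a = (Scheme.ΓSpecIso (.of O)).inv.hom a := fun a => rfl
  -- KEY: `ϖ` is a nonzerodivisor on `Γ(V(C'), V)` — checked on the stalks
  have hw : ∀ μ' : Γ(C'.subscheme, V),
      ((C'.subschemeι ≫ τ ≫ r).appLE ⊤ _ le_top).hom (eR ϖ) * μ' = 0 → μ' = 0 := by
    intro μ' hμ'
    apply TopCat.Presheaf.section_ext C'.subscheme.sheaf _ μ' 0
    intro z hz
    rw [map_zero]
    have hgerm := congrArg (C'.subscheme.presheaf.germ _ z hz).hom hμ'
    rw [map_mul, map_zero, heR, germ_appLE_top, Scheme.Hom.stalkMap_comp, Scheme.Hom.stalkMap_comp] at hgerm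
    change (C'.subschemeι.stalkMap z).hom ((τ.stalkMap _).hom ((r.stalkMap _).hom
      (((Spec (.of O)).presheaf.germ ⊤ _ trivial).hom ((Scheme.ΓSpecIso (.of O)).inv.hom ϖ)))) * _ = 0 at hgerm
    have hx'C : C'.subschemeι z ∈ (C'.support : Set X') := by
      rw [← Scheme.IdealSheafData.range_subschemeι]; exact Set.mem_range_self z
    -- the germ of `μ'` is `ι^♯ a`, and `ker ι^♯ = C'_{x'}`
    obtain ⟨a, ha⟩ := C'.subschemeι.stalkMap_surjective z ((C'.subscheme.presheaf.germ _ z hz).hom μ')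
    have hker : RingHom.ker (C'.subschemeι.stalkMap z).hom = stalkIdeal C' (C'.subschemeι z) := by
      rw [← stalkIdeal_ker_eq_ker_stalkMap, Scheme.IdealSheafData.ker_subschemeι]
    by_cases hy : r (τ (C'.subschemeι z)) = IsLocalRing.closedPoint O
    · -- over the closed point: `r^♯` of the germ of `ϖ` is the germ of `r^* ϖ`
      rw [Scheme.Hom.germ_stalkMap_apply] at hgerm
      change (C'.subschemeι.stalkMap z).hom ((τ.stalkMap _).hom
        ((X.presheaf.Γgerm _).hom (r.appTop.hom ((Scheme.ΓSpecIso (.of O)).inv.hom ϖ)))) * _ = 0 at hgerm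
      rw [← ha, ← map_mul, ← RingHom.mem_ker, hker] at hgerm
      suffices key : a ∈ stalkIdeal C' (C'.subschemeι z) by
        change (C'.subscheme.presheaf.germ _ z hz).hom μ' = 0
        rw [← ha]
        rw [← hker, RingHom.mem_ker] at key
        exact key
      by_cases hsupp : τ (C'.subschemeι z) ∈ (s.ker.support : Set X)
      · -- over the special point of the section
        have hp : τ (C'.subschemeι z) = s (IsLocalRing.closedPoint O) := by
          have hmem : τ (C'.subschemeι z) ∈ (s.ker.support : Set X) ∩ r ⁻¹' {IsLocalRing.closedPoint O} := ⟨hsupp, hy⟩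
          rw [support_ker_inter_preimage_closedPoint_of_section O r s hs] at hmem
          exact hmem
        exact mem_stalkIdeal_carrierStrictTransform_of_varpi_mul_mem hτ 𝓢 K _ (s (IsLocalRing.closedPoint O)) hp
          (by rw [← hp]; exact hsupp) c hcJ h𝓢 Φ hΦd hK (r.appTop.hom ((Scheme.ΓSpecIso (.of O)).inv.hom ϖ)) h𝔪 hdim hΦ𝔪
          hx'C a hgerm
      · -- off the section: the old flatness transports along the local isomorphism `τ`
        refine mem_stalkIdeal_carrierStrictTransform_of_mul_mem_of_not_mem_support hτ 𝓢 K _ hsupp _ (fun b hb => ?_) a hgerm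
        have hysupp : τ (C'.subschemeι z) ∈ ((𝓢 ⊔ K).support : Set X) := by
          by_contra hns
          have htop := stalkIdeal_eq_top_of_not_mem_support (I := 𝓢 ⊔ K) (x := τ (C'.subschemeι z)) (fun h => hns h)
          have h' := (mem_support_iff_stalkIdeal_le C' (C'.subschemeι z)).mp hx'C
          apply (IsLocalRing.maximalIdeal.isMaximal (X'.presheaf.stalk (C'.subschemeι z))).ne_top
          refine top_le_iff.mp (le_trans ?_ h')
          show ⊤ ≤ stalkIdeal (strictTransformIdeal τ s.ker 𝓢 ⊔ strictTransformIdeal τ s.ker K) (C'.subschemeι z)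
          rw [stalkIdeal_sup, stalkIdeal_strictTransformIdeal_of_not_mem_support s.ker 𝓢 hsupp,
            stalkIdeal_strictTransformIdeal_of_not_mem_support s.ker K hsupp, ← Ideal.map_sup, ← stalkIdeal_sup, htop,
            Ideal.map_top]
        exact mem_stalkIdeal_of_varpi_mul_mem_of_flat r (𝓢 ⊔ K) _ hysupp hϖ.ne_zero b hb
    · -- over the generic point: `ϖ` is a unit there
      have hunit := ((isUnit_germ_of_ne_closedPoint O _ hy hϖ.ne_zero).map (r.stalkMap _).hom).map
        (τ.stalkMap _).hom |>.map (C'.subschemeι.stalkMap z).hom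
      change (C'.subscheme.presheaf.germ _ z hz).hom μ' = 0
      exact (hunit.mul_right_eq_zero).mp hgerm
  -- conclude: `ρ • μ = u ϖⁿ μ = 0 ⇒ μ = 0`
  rw [hρeq, map_mul, map_pow, mul_assoc] at hμ
  have hμ' := ((u.isUnit.map eR).map _).mul_right_eq_zero.mp hμ
  clear hμ hρeq hu
  induction N generalizing μ with
  | zero => simpa using hμ'
  | succ N ih =>
    rw [pow_succ, mul_assoc] at hμ'
    exact hw μ (ih _ hμ')

/-- **K7b in the stage spelling of `TCPlus.Member` (ii)**: base `σ ≫ q` (a `Ch`-stage `σ : X → P` over `q : P → Spec O`), conclusion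
`Flat ((St_τ 𝓢 ⊔ St_τ K).subschemeι ≫ (τ ≫ σ) ≫ q)` for the new stage `(X′, τ ≫ σ)`. [cite: Hartshorne1977, III Prop. 9.7 p. 257] -/
theorem flat_carrierStrictTransform_subschemeι_comp_stage (O : Type) [CommRing O] [IsDomain O] [IsDiscreteValuationRing O]
    {X X' P : Scheme.{0}} (σ : X ⟶ P) (q : P ⟶ Spec (.of O)) [IsSeparated (σ ≫ q)]
    (s : Spec (.of O) ⟶ X) (hs : s ≫ σ ≫ q = 𝟙 _) (τ : X' ⟶ X) (hτ : IsBlowup τ s.ker)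
    [IsLocallyNoetherian X] [IsLocallyNoetherian X']
    (𝓢 K : X.IdealSheafData) (hflat : Flat ((𝓢 ⊔ K).subschemeι ≫ σ ≫ q))
    {n : ℕ} (c : Fin (n + 1) → X.presheaf.stalk (s (IsLocalRing.closedPoint O)))
    (hcJ : Ideal.span (Set.range c) = stalkIdeal s.ker (s (IsLocalRing.closedPoint O)))
    (h𝓢 : stalkIdeal 𝓢 (s (IsLocalRing.closedPoint O)) = Ideal.span {c 0})
    {m : ℕ} (Φ : MvPolynomial (Fin n) (X.presheaf.stalk (s (IsLocalRing.closedPoint O)))) (hΦd : Φ.IsHomogeneous m)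
    (hK : stalkIdeal K (s (IsLocalRing.closedPoint O)) = Ideal.span {MvPolynomial.eval (fun l => c l.succ) Φ})
    (ϖ : O) (hϖ : Irreducible ϖ)
    (h𝔪 : Ideal.span (Set.range c) ⊔ Ideal.span {(X.presheaf.Γgerm (s (IsLocalRing.closedPoint O))).hom
        ((σ ≫ q).appTop.hom ((Scheme.ΓSpecIso (.of O)).inv.hom ϖ))} =
      IsLocalRing.maximalIdeal (X.presheaf.stalk (s (IsLocalRing.closedPoint O))))
    (hdim : ringKrullDim (X.presheaf.stalk (s (IsLocalRing.closedPoint O))) = (n + 2 : ℕ))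
    (hΦ𝔪 : MvPolynomial.map (IsLocalRing.residue (X.presheaf.stalk (s (IsLocalRing.closedPoint O)))) Φ ≠ 0) :
    Flat ((strictTransformIdeal τ s.ker 𝓢 ⊔ strictTransformIdeal τ s.ker K).subschemeι ≫ (τ ≫ σ) ≫ q) := by
  have h := flat_carrierStrictTransform_subschemeι_comp O (σ ≫ q) s hs τ hτ 𝓢 K hflat c hcJ h𝓢 Φ hΦd hK ϖ hϖ h𝔪 hdim hΦ𝔪
  simpa only [Category.assoc] using h

end Flat

end Summit.ResolutionOfSingularities.ResolutionOfSingularities.Cruxes.EquisingularLiftNat.Sections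

end
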